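import Summits.Ventures.PackingBounds.Energy.TenPointCkNine
import Summits.Ventures.PackingBounds.Configurations.PetersenCode
import HarnessLib

/-!
# Ten points on `S³`, potential `(1+⟪x,y⟫)^9`: the two-sided statement (the Petersen code is optimal)

Framing: lottery ticket; floor = certified bounds/negative ranges. Venture `PackingBounds`, cell
`pub-packcert`, energy family E3PT (pub-packcert-energy gen 13).

Combines the kernel-checked sharp three-point bound `TenPointCkNine.ck9_ten_points`
(`Σ_{x ≠ y} (1+⟪x,y⟫)^9 ≥ 201769315/839808` for every ten unit vectors of `ℝ⁴`) with the Petersen code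
`Config.PetersenCode.exists_config` (inner products `1/6` (six per point) and `-2/3` (three per point)):
the minimum is exactly `201769315/839808 = 10·(3·(1/3)^9 + 6·(7/6)^9)` (ordered pairs), attained by the Petersen code —
the case `k = 9` of Cohn–Woo's observation (J. AMS 2012, §5.3) as a theorem.
-/

noncomputable section

open Finset
open scoped RealInnerProductSpace

namespace Summit.Ventures.PackingBounds.Energy.TenPointCkNine

open Summit.Ventures.PackingBounds.Config

/-- The Petersen code attains `201769315/839808`: ten unit vectors of `ℝ⁴` with `Σ_{x≠y} (1+⟪x,y⟫)^9 = 201769315/839808`. -/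
theorem petersen_ck9_energy : ∃ C : Finset (EuclideanSpace ℝ (Fin 4)), C.card = 10 ∧ (∀ x ∈ C, ‖x‖ = 1) ∧
    ∑ x ∈ C, ∑ y ∈ C.erase x, (1 + inner ℝ x y) ^ 9 = 201769315 / 839808 := by
  obtain ⟨C, hc, hn, _, he⟩ := PetersenCode.exists_config
  refine ⟨C, hc, hn, ?_⟩
  rw [he (fun t : ℝ => (1 + t) ^ 9)]
  norm_num

/-- **Ten points on `S³`, potential `(1+⟪x,y⟫)^9`, two-sided:** the least value of `Σ_{x ≠ y} (1+⟪x,y⟫)^9`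
over ten unit vectors of `ℝ⁴` is `201769315/839808`, attained by the Petersen code. -/
theorem ck9_ten_points_isLeast :
    IsLeast {E : ℝ | ∃ C : Finset (EuclideanSpace ℝ (Fin 4)), C.card = 10 ∧ (∀ x ∈ C, ‖x‖ = 1) ∧
      E = ∑ x ∈ C, ∑ y ∈ C.erase x, (1 + inner ℝ x y) ^ 9} (201769315 / 839808) := by
  obtain ⟨C0, hc0, hn0, he0⟩ := petersen_ck9_energy
  refine ⟨⟨C0, hc0, hn0, he0.symm⟩, ?_⟩
  rintro E ⟨C, h10, hC, rfl⟩
  simpa using ck9_ten_points C hC h10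

end Summit.Ventures.PackingBounds.Energy.TenPointCkNine
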